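import Mathlib
import HarnessLib
import Summits.NavierStokesRegularity.NavierStokesRegularity.Theorems.UnthreadedDoorNetFluxViscosityStep

/-!
# Route `UnthreadedDoor`, crux `PoloidalLiouville` (stmt-NavierStokesRegularity-1222), WALL W1 — crux idea «null-time», AE-4′ tooling:
# the viscosity inequality of the cumulative net flux from the one-sided law AT THE TOUCHING TIME

`viscosity_inequality_window_at` = ARM A g3's `viscosity_inequality_window` (`UnthreadedDoorNetFluxViscosityStep.lean`, p668673)
VERBATIM, except that the one-sided law (L) — hypothesis `hlaw`, there quantified over every time of the window but USED only at the touching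
time `−e^{−s₀}` (l.168 of the landed file) — is assumed at that single time.  This is the form consumed by the «null-time» window decay
(`Theorems/UnthreadedDoorNetFluxWindowDecayOffNull.lean`): there the law holds only at times outside a closed null set `D`, and the
off-null comparison `NetFlux.halfLineOU_decay_viscosity_offNull` (p687414) asks for the viscosity inequality only at touching times with
`−e^{−s₀} ∉ D`.  Pure real analysis; nothing here is an NS statement; 1222 / W1 / NS regularity OPEN.
`--supports stmt-NavierStokesRegularity-1222 --as helper`.  [folklore]
-/

-- the summit and its single problem share the name (D-0017 nested layout)
set_option linter.dupNamespace false

noncomputable section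

open Set Filter Topology MeasureTheory intervalIntegral

namespace Summit.NavierStokesRegularity.NavierStokesRegularity.Theorems.PoloidalLiouville.NetFlux

/-- **The viscosity inequality at a joint touching point, from the one-sided law AT THE TOUCHING TIME ONLY** — the landed
`viscosity_inequality_window` (ARM A g3) verbatim, with its hypothesis `hlaw` (quantified there over the whole window) restricted to the
single time `−e^{−s₀}` where the proof uses it; for the «null-time» window decay off a closed null set of times. [folklore] -/
theorem viscosity_inequality_window_at {w ℓp ℓm : ℝ → ℝ → ℝ} {t₀ K C : ℝ} (hC : 0 ≤ C)
    (hcont : ContinuousOn (fun p : ℝ × ℝ => w p.1 p.2) (Ioo t₀ 0 ×ˢ Ioi 0))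
    (hbd : ∀ t ∈ Ioo t₀ 0, ∀ r, 0 < r → 0 ≤ w t r ∧ w t r ≤ K * r / (-t))
    (hℓp : ∀ t ∈ Ioo t₀ 0, ∀ r > 0, HasDerivWithinAt (w t) (ℓp t r) (Ioi r) r)
    (hℓm : ∀ t ∈ Ioo t₀ 0, ∀ r > 0, HasDerivWithinAt (w t) (ℓm t r) (Iio r) r)

    (hnc : ∀ t₁ t₂ : ℝ, t₀ < t₁ → t₁ ≤ t₂ → t₂ < 0 → ∃ κ : ℝ, 0 ≤ κ ∧ ∀ a₀ : ℝ, 0 < a₀ → a₀ ≤ 1 →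
      (∀ t ∈ Icc t₁ t₂, (∀ a ∈ Ioo 0 a₀, w t a ≤ κ * a ^ 2) ∧
        LipschitzOnWith (Real.toNNReal (κ * a₀)) (fun r => w t r) (Ioo 0 a₀)) ∧
      (∀ t ∈ Icc t₁ t₂, ∀ t' ∈ Icc t₁ t₂, ∀ a ∈ Ioo 0 a₀, |w t a - w t' a| ≤ κ * a ^ 2 * |t - t'|))
    {U : ℝ → ℝ → ℝ} (hU : ∀ s ρ, U s ρ = ∫ r in (0:ℝ)..(ρ * Real.exp (-s / 2)), w (-Real.exp (-s)) r)
    (φ : ℝ → ℝ → ℝ) (φₛ : ℝ) (φ₁ φ₂ : ℝ → ℝ) (s₀ ρ₀ : ℝ) (hs₀ : t₀ < -Real.exp (-s₀)) (hρ₀ : 0 < ρ₀)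
    (hlaw : ∀ a R : ℝ, 0 < a → a < R → ∀ ε > 0, ∃ δ > 0, ∀ h ∈ Ioo 0 δ,
      (∫ r in Ioo a R, w (-Real.exp (-s₀)) r) - (∫ r in Ioo a R, w (-Real.exp (-s₀) - h) r)
        ≤ h * (ℓp (-Real.exp (-s₀)) R - ℓm (-Real.exp (-s₀)) a
          + C / Real.sqrt (-(-Real.exp (-s₀))) * (w (-Real.exp (-s₀)) R + w (-Real.exp (-s₀)) a) + ε))
    (hφs : HasDerivAt (fun σ => φ σ ρ₀) φₛ s₀) (hφ1 : ∀ r, HasDerivAt (φ s₀) (φ₁ r) r)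
    (hφ2 : ∀ r, HasDerivAt φ₁ (φ₂ r) r)
    (hmax : IsLocalMax (fun p : ℝ × ℝ => U p.1 p.2 - φ p.1 p.2) (s₀, ρ₀)) :
    φₛ ≤ φ₂ ρ₀ + (C - ρ₀ / 2) * φ₁ ρ₀ := by
  -- the touching point in physical variables
  set e₀ : ℝ := Real.exp (-s₀ / 2) with he₀
  set tS : ℝ := -Real.exp (-s₀) with htS_def
  have he₀pos : 0 < e₀ := Real.exp_pos _
  have he₀sq : e₀ ^ 2 = Real.exp (-s₀) := by rw [he₀, sq, ← Real.exp_add]; ring_nf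
  have htSneg : -tS = e₀ ^ 2 := by rw [htS_def, he₀sq, neg_neg]
  have htS : tS ∈ Ioo t₀ 0 := ⟨hs₀, by rw [htS_def]; exact neg_neg_of_pos (Real.exp_pos _)⟩
  have hsqrt : Real.sqrt (-tS) = e₀ := by rw [htSneg, Real.sqrt_sq he₀pos.le]
  set R₀ : ℝ := ρ₀ * e₀ with hR₀
  have hR₀pos : 0 < R₀ := mul_pos hρ₀ he₀pos
  set wS : ℝ := w tS R₀ with hwS
  set ℓS : ℝ := ℓp tS R₀ with hℓS
  have hwS0 : 0 ≤ wS := (hbd tS htS R₀ hR₀pos).1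
  -- (ρ): Fermat and the one-sided second-order inequality
  have hUs₀ : U s₀ = fun ρ => ∫ r in (0:ℝ)..(ρ * e₀), w tS r := by
    funext ρ; rw [hU]
  have hUρ : ∀ᶠ ρ in 𝓝 ρ₀, HasDerivAt (U s₀) (e₀ * w tS (ρ * e₀)) ρ := by
    filter_upwards [Ioi_mem_nhds hρ₀] with ρ hρ
    rw [hUs₀]
    have h1 := hasDerivAt_window_primitive hcont hbd htS (mul_pos hρ he₀pos)
    have h2 := h1.comp ρ (hasDerivAt_mul_const e₀)
    have h3 : HasDerivAt (fun ρ' => ∫ r in (0:ℝ)..(ρ' * e₀), w tS r) (w tS (ρ * e₀) * e₀) ρ := by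
      simpa only [Function.comp_def] using h2
    exact h3.congr_deriv (mul_comm _ _)
  have hu : HasDerivWithinAt (fun ρ => e₀ * w tS (ρ * e₀)) (e₀ * (ℓS * e₀)) (Ioi ρ₀) ρ₀ := by
    have h1 : HasDerivWithinAt (w tS) ℓS (Ioi R₀) (ρ₀ * e₀) := hℓp tS htS R₀ hR₀pos
    have h2 : HasDerivWithinAt (fun ρ : ℝ => ρ * e₀) e₀ (Ioi ρ₀) ρ₀ := (hasDerivAt_mul_const e₀).hasDerivWithinAt
    have h3 := h1.comp ρ₀ h2 (fun ρ hρ => by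
      show ρ * e₀ ∈ Ioi R₀; exact mul_lt_mul_of_pos_right hρ he₀pos)
    exact h3.const_mul e₀
  obtain ⟨hF1, hF2⟩ := touching_rightDeriv_le_of_jointLocalMax U φ (fun ρ => e₀ * w tS (ρ * e₀)) φ₁ φ₂
    (e₀ * (ℓS * e₀)) s₀ ρ₀ hmax hφ1 hφ2 hUρ hu
  -- hF1 : e₀ * w tS (ρ₀ * e₀) = φ₁ ρ₀ ;  hF2 : e₀ * (ℓS * e₀) ≤ φ₂ ρ₀
  have hF1' : e₀ * wS = φ₁ ρ₀ := hF1
  -- (s): past difference quotients from the joint local max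
  obtain ⟨-, -, hiii⟩ := touching_oneSided_of_jointLocalMax U φ φₛ (e₀ * w tS (ρ₀ * e₀)) φ₁ φ₂ s₀ ρ₀ hmax hφs
    hφ1 hφ2 hUρ.self_of_nhds
  -- MAIN CLAIM: an upper bound for the same quotients
  set M : ℝ := 2 * e₀ ^ 2 + 1 + 2 * R₀ with hM
  have hMpos : 0 < M := by rw [hM]; positivity
  set RHS : ℝ := e₀ ^ 2 * ℓS + e₀ ^ 2 * (C / Real.sqrt (-tS)) * wS - R₀ / 2 * wS with hRHS
  have hclaim : ∀ η : ℝ, 0 < η → η ≤ 1 → φₛ ≤ RHS + η * (M + 1) := by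
    intro η hη hη1
    -- near-centre constants on `[tm, tS]`
    set tm : ℝ := (t₀ + tS) / 2 with htm
    have htm1 : t₀ < tm := by rw [htm]; linarith [htS.1]
    have htm2 : tm ≤ tS := by rw [htm]; linarith [htS.1]
    obtain ⟨κ, hκ, hNC⟩ := hnc tm tS htm1 htm2 htS.2
    set VS : ℝ := C / Real.sqrt (-tS) with hVS
    have hVS0 : 0 ≤ VS := by rw [hVS, hsqrt]; exact div_nonneg hC he₀pos.le
    -- the inner cut-off radius
    set a₀ : ℝ := min (min 1 R₀) (η / (2 * κ + VS * κ + 1)) with ha₀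
    have hden : 0 < 2 * κ + VS * κ + 1 := by positivity
    have ha₀pos : 0 < a₀ := by rw [ha₀]; exact lt_min (lt_min one_pos hR₀pos) (div_pos hη hden)
    have ha₀1 : a₀ ≤ 1 := le_trans (min_le_left _ _) (min_le_left _ _)
    have ha₀R : a₀ ≤ R₀ := le_trans (min_le_left _ _) (min_le_right _ _)
    have ha₀η : (2 * κ + VS * κ + 1) * a₀ ≤ η := by
      have := min_le_right (min 1 R₀) (η / (2 * κ + VS * κ + 1))
      rw [← ha₀] at this
      calc (2 * κ + VS * κ + 1) * a₀ ≤ (2 * κ + VS * κ + 1) * (η / (2 * κ + VS * κ + 1)) :=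
            mul_le_mul_of_nonneg_left this hden.le
        _ = η := by field_simp
    set a : ℝ := a₀ / 2 with ha
    have hapos : 0 < a := by rw [ha]; linarith
    have haa₀ : a < a₀ := by rw [ha]; linarith
    have haR : a < R₀ := lt_of_lt_of_le haa₀ ha₀R
    have ha1 : a ≤ 1 := le_trans haa₀.le ha₀1
    obtain ⟨hNCa, hNCb⟩ := hNC a₀ ha₀pos ha₀1
    have hmemS : tS ∈ Icc tm tS := ⟨htm2, le_rfl⟩
    -- the three inner error terms
    have hℓm_bd : |ℓm tS a| ≤ κ * a₀ := by
      have h := abs_le_of_hasDerivWithinAt_Iio_of_lipschitzOnWith (hNCa tS hmemS).2 ⟨hapos, haa₀⟩ (hℓm tS htS a hapos)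
      rwa [Real.coe_toNNReal _ (mul_nonneg hκ ha₀pos.le)] at h
    have hwa : w tS a ≤ κ * a ^ 2 := (hNCa tS hmemS).1 a ⟨hapos, haa₀⟩
    have hEin : κ * a₀ + VS * (κ * a ^ 2) + κ * a₀ ^ 2 * a ≤ η := by
      have h1 : a ^ 2 ≤ a₀ := by
        calc a ^ 2 = a₀ * (a₀ / 4) := by rw [ha]; ring
          _ ≤ a₀ * 1 := mul_le_mul_of_nonneg_left (by linarith) ha₀pos.le
          _ = a₀ := mul_one _
      have h2 : a₀ ^ 2 * a ≤ a₀ := by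
        calc a₀ ^ 2 * a = a₀ * (a₀ * a) := by ring
          _ ≤ a₀ * 1 := mul_le_mul_of_nonneg_left (by
              calc a₀ * a ≤ 1 * 1 := mul_le_mul ha₀1 ha1 hapos.le zero_le_one
                _ = 1 := one_mul _) ha₀pos.le
          _ = a₀ := mul_one _
      have p1 : VS * (κ * a ^ 2) ≤ VS * (κ * a₀) :=
        mul_le_mul_of_nonneg_left (mul_le_mul_of_nonneg_left h1 hκ) hVS0
      have p2 : κ * a₀ ^ 2 * a ≤ κ * a₀ := by
        calc κ * a₀ ^ 2 * a = κ * (a₀ ^ 2 * a) := by ring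
          _ ≤ κ * a₀ := mul_le_mul_of_nonneg_left h2 hκ
      linarith [p1, p2, ha₀η, ha₀pos.le]
    -- (L) at `(tS, a, R₀)` with `ε = η`
    obtain ⟨δ, hδ, hL⟩ := hlaw a R₀ hapos haR η hη
    -- joint continuity of `w` at `(tS, R₀)`
    have hwcont : ContinuousAt (fun p : ℝ × ℝ => w p.1 p.2) (tS, R₀) :=
      hcont.continuousAt ((isOpen_Ioo.prod isOpen_Ioi).mem_nhds ⟨htS, hR₀pos⟩)
    obtain ⟨δ₂, hδ₂, hw2⟩ : ∃ δ₂ > 0, ∀ t' r, |t' - tS| < δ₂ → |r - R₀| < δ₂ → |w t' r - wS| < η := by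
      have h := Metric.continuousAt_iff.mp hwcont η hη
      obtain ⟨δ₂, hδ₂, h⟩ := h
      refine ⟨δ₂, hδ₂, fun t' r h1 h2 => ?_⟩
      have h3 := @h (t', r) (by
        rw [Prod.dist_eq, Real.dist_eq, Real.dist_eq]; exact max_lt h1 h2)
      rwa [Real.dist_eq] at h3
    -- the parametrisation `σ ↦ (h σ, k σ)`
    set hσ : ℝ → ℝ := fun σ => e₀ ^ 2 * (Real.exp σ - 1) with hhσ
    set kσ : ℝ → ℝ := fun σ => R₀ * (Real.exp (σ / 2) - 1) with hkσ
    have Th : Tendsto hσ (𝓝 0) (𝓝 0) := by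
      have hc : Continuous hσ := by rw [hhσ]; fun_prop
      simpa [hhσ] using hc.tendsto 0
    have Tk : Tendsto kσ (𝓝 0) (𝓝 0) := by
      have hc : Continuous kσ := by rw [hkσ]; fun_prop
      simpa [hkσ] using hc.tendsto 0
    set Y : ℝ := ℓS + VS * wS + 2 * η with hY
    have TY : Tendsto (fun σ => e₀ ^ 2 * (Real.exp σ - 1) * |Y|) (𝓝 0) (𝓝 0) := by
      have hc : Continuous (fun σ => e₀ ^ 2 * (Real.exp σ - 1) * |Y|) := by fun_prop
      simpa using hc.tendsto 0
    set δ' : ℝ := min δ ((tS - t₀) / 2) with hδ'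
    have hδ'pos : 0 < δ' := lt_min hδ (by linarith [htS.1])
    have hev : ∀ᶠ σ in 𝓝[>] (0:ℝ), 0 < σ ∧ σ < 1 ∧ hσ σ < δ' ∧ hσ σ < δ₂ ∧ kσ σ < δ₂ ∧
        e₀ ^ 2 * (Real.exp σ - 1) * |Y| < η := by
      have h0 : ∀ᶠ σ in 𝓝[>] (0:ℝ), 0 < σ := self_mem_nhdsWithin
      have h1 : ∀ᶠ σ in 𝓝[>] (0:ℝ), σ < 1 := mem_nhdsWithin_of_mem_nhds (gt_mem_nhds one_pos)
      have h2 : ∀ᶠ σ in 𝓝[>] (0:ℝ), hσ σ < δ' := mem_nhdsWithin_of_mem_nhds (Th.eventually (gt_mem_nhds hδ'pos))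
      have h3 : ∀ᶠ σ in 𝓝[>] (0:ℝ), hσ σ < δ₂ := mem_nhdsWithin_of_mem_nhds (Th.eventually (gt_mem_nhds hδ₂))
      have h4 : ∀ᶠ σ in 𝓝[>] (0:ℝ), kσ σ < δ₂ := mem_nhdsWithin_of_mem_nhds (Tk.eventually (gt_mem_nhds hδ₂))
      have h5 : ∀ᶠ σ in 𝓝[>] (0:ℝ), e₀ ^ 2 * (Real.exp σ - 1) * |Y| < η :=
        mem_nhdsWithin_of_mem_nhds (TY.eventually (gt_mem_nhds hη))
      filter_upwards [h0, h1, h2, h3, h4, h5] with σ a1 a2 a3 a4 a5 a6 using ⟨a1, a2, a3, a4, a5, a6⟩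
    -- the upper bound on the quotient, for every such `σ`
    have hUB : ∀ᶠ σ in 𝓝[>] (0:ℝ), (U s₀ ρ₀ - U (s₀ - σ) ρ₀) / σ ≤ RHS + η * M := by
      filter_upwards [hev] with σ hσall
      obtain ⟨hσpos, hσ1, hσδ', hσδ₂, hkδ₂, hYσ⟩ := hσall
      -- names
      set h : ℝ := hσ σ with hh
      set k : ℝ := kσ σ with hk
      have hexp1 : 1 < Real.exp σ := Real.one_lt_exp_iff.mpr hσpos
      have hexp2 : 1 < Real.exp (σ / 2) := Real.one_lt_exp_iff.mpr (by linarith)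
      have hhpos : 0 < h := by rw [hh, hhσ]; exact mul_pos (pow_pos he₀pos 2) (by linarith)
      have hkpos : 0 < k := by rw [hk, hkσ]; exact mul_pos hR₀pos (by linarith)
      have hh_lo : e₀ ^ 2 * σ ≤ h := by
        rw [hh, hhσ]; exact mul_le_mul_of_nonneg_left (by linarith [Real.add_one_le_exp σ]) (pow_pos he₀pos 2).le
      have hh_hi : h ≤ e₀ ^ 2 * (σ * Real.exp σ) := by
        rw [hh, hhσ]; exact mul_le_mul_of_nonneg_left (exp_sub_one_le_mul_exp σ) (pow_pos he₀pos 2).le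
      have hk_lo : R₀ * (σ / 2) ≤ k := by
        rw [hk, hkσ]; exact mul_le_mul_of_nonneg_left (by linarith [Real.add_one_le_exp (σ / 2)]) hR₀pos.le
      have hk_hi : k ≤ 2 * R₀ * σ := by
        rw [hk, hkσ]
        have h1 : Real.exp (σ / 2) - 1 ≤ σ / 2 * Real.exp (σ / 2) := exp_sub_one_le_mul_exp (σ / 2)
        have h2 : Real.exp (σ / 2) ≤ Real.exp 1 := Real.exp_le_exp.mpr (by linarith)
        have h3 : Real.exp 1 < 3 := lt_trans Real.exp_one_lt_d9 (by norm_num)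
        have h4 : σ / 2 * Real.exp (σ / 2) ≤ σ / 2 * 3 := mul_le_mul_of_nonneg_left (h2.trans h3.le) (by linarith)
        have h5 := mul_pos hR₀pos hσpos
        calc R₀ * (Real.exp (σ / 2) - 1) ≤ R₀ * (σ / 2 * 3) := mul_le_mul_of_nonneg_left (h1.trans h4) hR₀pos.le
          _ ≤ 2 * R₀ * σ := by linarith
      have hhδ : h < δ := lt_of_lt_of_le hσδ' (min_le_left _ _)
      have hht : h ≤ (tS - t₀) / 2 := le_trans hσδ'.le (min_le_right _ _)
      have htSh : tS - h ∈ Ioo t₀ 0 := ⟨by linarith [htS.1], by linarith [htS.2]⟩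
      have htSh' : tS - h ∈ Icc tm tS := ⟨by rw [htm]; linarith, by linarith⟩
      -- rewrite the two values of `U`
      have hU1 : U s₀ ρ₀ = ∫ r in (0:ℝ)..R₀, w tS r := by rw [hU]
      have hU2 : U (s₀ - σ) ρ₀ = ∫ r in (0:ℝ)..(R₀ + k), w (tS - h) r := by
        rw [hU]
        have e1 : ρ₀ * Real.exp (-(s₀ - σ) / 2) = R₀ + k := by
          rw [show -(s₀ - σ) / 2 = -s₀ / 2 + σ / 2 by ring, Real.exp_add, hk, hkσ, hR₀, he₀]; ring
        have e2 : -Real.exp (-(s₀ - σ)) = tS - h := by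
          rw [show -(s₀ - σ) = -s₀ + σ by ring, Real.exp_add, hh, hhσ, he₀sq, htS_def]; ring
        rw [e1, e2]
      -- integrability
      have hI1 : ∀ {x y : ℝ}, 0 ≤ x → 0 ≤ y → IntervalIntegrable (w tS) volume x y := fun hx hy =>
        window_intervalIntegrable hcont hbd htS hx hy
      have hI2 : ∀ {x y : ℝ}, 0 ≤ x → 0 ≤ y → IntervalIntegrable (w (tS - h)) volume x y := fun hx hy =>
        window_intervalIntegrable hcont hbd htSh hx hy
      -- D2 ≥ k (wS − η)
      have hD2 : k * (wS - η) ≤ (∫ r in (0:ℝ)..(R₀ + k), w (tS - h) r) - ∫ r in (0:ℝ)..R₀, w (tS - h) r := by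
        rw [intervalIntegral.integral_interval_sub_left (hI2 le_rfl (by linarith)) (hI2 le_rfl hR₀pos.le)]
        have hmono := intervalIntegral.integral_mono_on (μ := volume) (a := R₀) (b := R₀ + k) (by linarith)
          (f := fun _ => wS - η) (g := w (tS - h)) intervalIntegrable_const (hI2 hR₀pos.le (by linarith))
          (fun r hr => by
            have h1 : |r - R₀| < δ₂ := by
              rw [abs_lt]; constructor <;> linarith [hr.1, hr.2]
            have h2 : |tS - h - tS| < δ₂ := by
              rw [show tS - h - tS = -h by ring, abs_neg, abs_of_pos hhpos]; exact hσδ₂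
            have := hw2 (tS - h) r h2 h1
            rw [abs_lt] at this; linarith [this.1])
        have hc : ∫ _ in R₀..(R₀ + k), (wS - η) = k * (wS - η) := by
          rw [intervalIntegral.integral_const, smul_eq_mul]; ring
        linarith [hmono, hc]
      -- D1 ≤ h · Y
      have hD1 : (∫ r in (0:ℝ)..R₀, w tS r) - (∫ r in (0:ℝ)..R₀, w (tS - h) r) ≤ h * Y := by
        have hsplit1 : (∫ r in (0:ℝ)..R₀, w tS r) = (∫ r in a..R₀, w tS r) + ∫ r in (0:ℝ)..a, w tS r := by
          rw [← intervalIntegral.integral_interval_sub_left (hI1 le_rfl hR₀pos.le) (hI1 le_rfl hapos.le)]; ring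
        have hsplit2 : (∫ r in (0:ℝ)..R₀, w (tS - h) r)
            = (∫ r in a..R₀, w (tS - h) r) + ∫ r in (0:ℝ)..a, w (tS - h) r := by
          rw [← intervalIntegral.integral_interval_sub_left (hI2 le_rfl hR₀pos.le) (hI2 le_rfl hapos.le)]; ring
        -- the law on `[a, R₀]`
        have hLaw := hL h ⟨hhpos, hhδ⟩
        rw [setIntegral_Ioo_eq_intervalIntegral _ haR.le, setIntegral_Ioo_eq_intervalIntegral _ haR.le] at hLaw
        -- the inner piece on `[0, a]`
        have hinner : (∫ r in (0:ℝ)..a, w tS r) - (∫ r in (0:ℝ)..a, w (tS - h) r) ≤ κ * a₀ ^ 2 * h * a := by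
          rw [← intervalIntegral.integral_sub (hI1 le_rfl hapos.le) (hI2 le_rfl hapos.le)]
          have hb := intervalIntegral.norm_integral_le_of_norm_le_const (a := (0:ℝ)) (b := a) (C := κ * a₀ ^ 2 * h)
            (f := fun r => w tS r - w (tS - h) r) (fun r hr => by
              rw [uIoc_of_le hapos.le] at hr
              have hr' : r ∈ Ioo 0 a₀ := ⟨hr.1, lt_of_le_of_lt hr.2 haa₀⟩
              have h1 := hNCb tS hmemS (tS - h) htSh' r hr'
              rw [show tS - (tS - h) = h by ring, abs_of_pos hhpos] at h1
              rw [Real.norm_eq_abs]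
              calc |w tS r - w (tS - h) r| ≤ κ * r ^ 2 * h := h1
                _ ≤ κ * a₀ ^ 2 * h := by
                    apply mul_le_mul_of_nonneg_right _ hhpos.le
                    apply mul_le_mul_of_nonneg_left _ hκ
                    exact pow_le_pow_left₀ hr.1.le (hr.2.trans haa₀.le) 2)
          rw [sub_zero, abs_of_pos hapos, Real.norm_eq_abs] at hb
          exact le_trans (le_abs_self _) hb
        have hneg : -ℓm tS a ≤ κ * a₀ := le_trans (neg_le_abs _) hℓm_bd
        rw [hsplit1, hsplit2]
        have hY' : h * (ℓS - ℓm tS a + VS * (wS + w tS a) + η) + κ * a₀ ^ 2 * h * a ≤ h * Y := by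
          rw [hY]
          have p1 : VS * w tS a ≤ VS * (κ * a ^ 2) := mul_le_mul_of_nonneg_left hwa hVS0
          have : ℓS - ℓm tS a + VS * (wS + w tS a) + η + κ * a₀ ^ 2 * a ≤ ℓS + VS * wS + 2 * η := by
            linarith [p1, hEin, hneg]
          have p2 := mul_le_mul_of_nonneg_left this hhpos.le
          linarith [p2]
        linarith [hLaw, hinner, hY']
      -- D1/σ ≤ e₀² Y + η
      have hD1σ : ((∫ r in (0:ℝ)..R₀, w tS r) - (∫ r in (0:ℝ)..R₀, w (tS - h) r)) / σ ≤ e₀ ^ 2 * Y + η := by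
        rw [div_le_iff₀ hσpos]
        rcases le_or_gt 0 Y with hY0 | hY0
        · have h1 : h * Y ≤ e₀ ^ 2 * (σ * Real.exp σ) * Y := mul_le_mul_of_nonneg_right hh_hi hY0
          have h3 : e₀ ^ 2 * (Real.exp σ - 1) * Y ≤ η := by
            rw [← abs_of_nonneg hY0]; exact hYσ.le
          have h4 := mul_le_mul_of_nonneg_right h3 hσpos.le
          linarith [hD1, h1, h4]
        · have h1 : h * Y ≤ e₀ ^ 2 * σ * Y := mul_le_mul_of_nonpos_right hh_lo hY0.le
          have h4 := mul_nonneg hη.le hσpos.le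
          linarith [hD1, h1, h4]
      -- assemble
      have hquot : (U s₀ ρ₀ - U (s₀ - σ) ρ₀) / σ
          = ((∫ r in (0:ℝ)..R₀, w tS r) - (∫ r in (0:ℝ)..R₀, w (tS - h) r)) / σ
            - ((∫ r in (0:ℝ)..(R₀ + k), w (tS - h) r) - ∫ r in (0:ℝ)..R₀, w (tS - h) r) / σ := by
        rw [hU1, hU2]; ring
      rw [hquot]
      have hD2σ : R₀ / 2 * wS - 2 * R₀ * η
          ≤ ((∫ r in (0:ℝ)..(R₀ + k), w (tS - h) r) - ∫ r in (0:ℝ)..R₀, w (tS - h) r) / σ := by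
        rw [le_div_iff₀ hσpos]
        have h1 : k * (wS - η) = k * wS - k * η := by ring
        have h2 : R₀ * (σ / 2) * wS ≤ k * wS := mul_le_mul_of_nonneg_right hk_lo hwS0
        have h3 : k * η ≤ 2 * R₀ * σ * η := mul_le_mul_of_nonneg_right hk_hi hη.le
        linarith [hD2, h2, h3]
      have : e₀ ^ 2 * Y + η - (R₀ / 2 * wS - 2 * R₀ * η) = RHS + η * M := by
        rw [hY, hRHS, hM, hVS]; ring
      linarith
    -- combine with (iii)
    obtain ⟨σ, hσ1, hσ2⟩ := ((hiii η hη).and hUB).exists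
    linarith
  -- let `η ↓ 0`
  have hφ : φₛ ≤ RHS := by
    refine le_of_forall_pos_le_add fun ε hε => ?_
    have h := hclaim (min 1 (ε / (M + 1))) (lt_min one_pos (div_pos hε (by linarith))) (min_le_left _ _)
    have h2 : min 1 (ε / (M + 1)) * (M + 1) ≤ ε := by
      calc min 1 (ε / (M + 1)) * (M + 1) ≤ ε / (M + 1) * (M + 1) :=
            mul_le_mul_of_nonneg_right (min_le_right _ _) (by linarith)
        _ = ε := by field_simp
    linarith
  -- substitute Fermat and the second-order inequality
  have hV : e₀ ^ 2 * (C / Real.sqrt (-tS)) * wS = C * (e₀ * wS) := by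
    rw [hsqrt]; field_simp
  have hR : R₀ / 2 * wS = ρ₀ / 2 * (e₀ * wS) := by rw [hR₀]; ring
  have hF2' : e₀ ^ 2 * ℓS ≤ φ₂ ρ₀ := by
    have : e₀ * (ℓS * e₀) = e₀ ^ 2 * ℓS := by ring
    linarith [hF2]
  rw [hRHS, hV, hR, hF1'] at hφ
  linarith [hφ, hF2']

end Summit.NavierStokesRegularity.NavierStokesRegularity.Theorems.PoloidalLiouville.NetFlux

end
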